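import Summits.HodgeConjecture.HodgeConjecture.Theses.AffinePartDecay
import Summits.HodgeConjecture.HodgeConjecture.Theses.AnchorTransport
import Literature.AlgebraicGeometry.HodgeTheory.IncidenceDivisorDescent
import Literature.AlgebraicGeometry.Motives.UniversalHyperplaneSectionSmoothProjective
import Literature.AlgebraicGeometry.HodgeTheory.AlgebraicClassesHodgeTypeHolds
import Literature.AlgebraicGeometry.HodgeTheory.HodgeTypePullback
import HarnessLib

/-!
# Line `sideways_vhc_sweep` — an ALTERNATIVE skeleton for the crux `WeakLefschetzAlgebraicClasses` (stmt-HodgeConjecture-1968)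

Route `AffinePartDecay` (route-HodgeConjecture-AffinePartDecay), crux #2 `WeakLefschetzAlgebraicClasses`
(weak Lefschetz for ALGEBRAIC classes: `i : H ⟶ X` a closed immersion of smooth projective complex
varieties, `dim X = n + 1`, `dim H = n`, `X ∖ i(H)` affine, `2p ≤ n`, `c ∈ H²ᵖ(X(ℂ); ℂ)` rational with
`i^*c ∈ Alg^p(H)` ⟹ `c ∈ Alg^p(X)`). Strategist line (seat `planner-cstrat-stmt-HodgeConjecture-1968-s2-0`,
2026-08-17), registered BESIDE the live line `Lines/birth.lean` (never overwriting it).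

## Why another line

`birth` cuts the crux as HODGE-TYPE REFLECTION + GYSIN TRANSPORT + LEFSCHETZ DIVISION; its open stub
`stub_lefschetzDivision` ("`L_H c ∈ Alg^{p+1}(X)` ⇒ `c ∈ Alg^p(X)` for rational `(p,p)`-classes") is the
sub-middle, algebraic-input fragment of Grothendieck's `A(X, η)` — `B(X)`-strength, no engine in the tree
or in print beyond abelian / flag / motivated cases (birth.md). THIS line never divides by `[H]`. It moves
the algebraicity of `c` SIDEWAYS, from the one divisor `H` where it is given to ALL smooth hyperplane
sections of a projective embedding of `X`, by Grothendieck's VARIATIONAL HODGE CONJECTURE — the OPEN crux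
`Theses.AnchorTransport.VariationalHodge` (stmt-HodgeConjecture-1076) of the sibling route `AnchorTransport`,
imported here BY NAME (staffed there; lines `padic_disc_transport`, `tame_symbol_splitting`,
`codim_split_motivic`; André `B ⇒ VHC` landed) — and then comes back DOWN to `X` through the universal
hyperplane family `𝒴 ⊂ X × (ℙᴺ)^*` by SPREADING (relative Hilbert scheme + Baire + monodromy averaging,
Voisin II §3.3.1 / §10.2.1) and the tree's PROVED incidence-divisor descent
`HodgeTheory.mem_algebraicClasses_of_spread` (`IncidenceDivisorDescent`: the coniveau ladder
`π_{j+1} = Φ_j − w ∪ π_j` on `X × (ℙᴺ)^*`, "no blow-ups, no Hodge types, no rationality, no induction on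
`p`"). The transfer target VHC has a concrete why-easier that division lacks: it is a statement about a
PROPER SMOOTH FAMILY, attackable by the formal deformation theory of cycle classes (Bloch 1972
semiregularity; Buchweitz–Flenner 2003; Bloch–Esnault–Kerz 2014, `paper:arxiv-1310.1773`, Thm. 1.2 /
"infinitesimal Hodge ⇔ variational Hodge", §7; Charles–Schnell, Conj. 11.3.1, Cor. 11.3.6) and by André's motivated cycles (`B ⇒ VHC`, in tree) — none
of which says anything about dividing by a divisor class.

## The five registered stubs and the sorry-free composition

* `stub_hodgeTypeReflected` (R) — verbatim the reflection stub of `birth` (theorem-grade, size M; shared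
  with that line: one proof closes both): `i^*c ∈ Alg^p(H)`, `2p ≤ n`, affine complement ⇒ `c` is of Hodge
  type `(p,p)` on `X` (algebraic ⇒ Hodge on `H`, `i^*` preserves each `H^{a,b}`, `i^*` injective in degree
  `2p ≤ n` by Andreotti–Frankel = the landed `Theorems.weakLefschetzInjective_proof`).
* `stub_variationalHodge` (V) — `Theses.AnchorTransport.VariationalHodge` BY NAME (open; do not duplicate
  work: it is crux stmt-HodgeConjecture-1076). Stubs (A) and (T) consume only its special case for
  PROJECTIVE families (the printed conjecture; the glue derives it from (V) in one line), which the landed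
  `Theorems.variationalHodge_projective_of_standardConjectureB` derives from the standard conjecture `B`
  over affine bases (André 1996) — so a proof of the printed form also feeds this line.
* `stub_anchorOnHyperplaneSection` (A) — THE ANCHOR: under VHC, in the crux's setting with `p ≥ 1` and `c`
  rational of type `(p,p)`, there is a projective embedding `e` of `X` and ONE smooth hyperplane section
  `X_{a₀}` of `e` on which `c` is algebraic. Very ample `H`: `e` = an embedding having `H` as a hyperplane
  section, `a₀` that section (transport of `Alg` under the iso `H ≅ X_{a₀}`). Ample `H`: the `m`-fold cyclic
  cover `π : Y → X` branched along a general `G ∈ |mH|` carries the linear pencil `⟨π^*s_H, u⟩ ⊂ |π^*𝒪(H)|`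
  (`uᵐ = π^*g`) with SMOOTH members `π⁻¹(H)` (cyclic cover of `H`; `(π^*c)|` algebraic by finite pull-back of
  supports), `{u = 0} ≅ G` and `Y_t ≅ G_t := {g = tᵐ s_Hᵐ} ∈ |mH|`; VHC along its smooth locus makes `c`
  algebraic on a smooth `G_t`, a hyperplane section of the embedding by `|mH|`. NON-AMPLE `H` with affine
  complement (Zariski–Goodman, Hartshorne LNM 156 II §5: in dimension `≥ 3` an affine complement does not make `H` ample): NO MECHANISM KNOWN — the stub is still implied
  by the Hodge conjecture (hence irrefutable short of ¬HC), and this is the line's declared hole; the route's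
  own `Assembly` only ever feeds hyperplane sections to the crux (see the card, §Transfer).
* `stub_sidewaysTransfer` (T) — SIDEWAYS BY VHC: under VHC, a rational `(p,p)`-class on `X` algebraic on one
  smooth hyperplane section `X_{a₀}` of `e` is algebraic on every smooth hyperplane section `X_a` of `e`
  (the smooth sections form a smooth projective family over the irreducible smooth good locus
  `U ⊂ (ℙᴺ)^*` — `Motives.UniversalHyperplaneSectionFamilyGoodLocus`, `HodgeTheory.HyperplaneSectionFamilyGoodFibres`
  — and `toX^* c` is fibrewise rational and `(p,p)`; size M on the tree's carriers).
* `stub_universalSpread` (S) — SPREADING OVER THE COMPLETE LINEAR SYSTEM: the hypothesis `hS` of the tree's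
  `HodgeTheory.mem_algebraicClasses_of_two_mul_le_of_spread`, VERBATIM but GUARDED by `1 ≤ p`, `2p ≤ m`
  (unguarded, `hS` fails for `m = 0`: a plane conic has no smooth INTEGRAL hyperplane section, so its `∃ a`
  cannot be met — recorded in the card): fibrewise algebraic classes on the smooth hyperplane sections come
  from ONE algebraic class `ξ` on `𝒴`, up to a positive integer multiple, on some smooth `X_a`. Documented
  tree gap ("not proved in the tree: it needs relative Hilbert/Chow schemes of `𝒴/P` and the countability
  argument", `IncidenceDivisorDescent` module docstring); print-routine (Voisin II §3.3.1, §10.2.1;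
  Charles–Schnell §11.3), size L; its `ℙ¹`-base analogue (I) `spread_supports_over_projectiveLine`
  is PROVED in the tree (`SpreadSupportsOfSmoothFamily`), the averaging half (II)
  `vertical_rigidity_supportedClasses_projectiveLine` is stated there with its printed mechanism.
* `weakLefschetz_of_pieces` — the REAL composition (sorry-free): `p = 0` by `algebraicClasses_zero`; else
  Hodge type by (R), anchor by (A), all smooth sections by (T), spread class `ξ` by (S), `𝒴` smooth
  projective by `Motives.isSmoothProjective_universalHyperplaneSection`, weak Lefschetz injectivity for the
  smooth section by `injective_complexBettiMap_hypersurfaceSection`, conclusion by the landed descent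
  `mem_algebraicClasses_of_spread`.
* `WeakLefschetzAlgebraicClasses_of : WeakLefschetzAlgebraicClasses` — the crux BY NAME from the five stubs.

`sorry` occurs ONLY in the five `stub_*` theorems.

## Disproof used

None exists: no `Cruxes/WeakLefschetzAlgebraicClasses/Disproof.lean`, no `Theorems/…/Negative/` lemma for
this crux (2026-08-17); `ledger negatives --problem HodgeConjecture` (MilnorK symbol lift, Fermat K3
exhaustion, E-line transport) does not bear on weak Lefschetz, VHC or spreading. The refuter record on the
item (HC-implied via reflection + injectivity; `B(X)`-implied; first open `p = 2`, `dim X = 5`) is honoured: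
(R) is that reflection; (A), (T), (S) are each implied by HC; no stub restates the crux (BC3 probes in the
card) and none divides by `[H]`.

## References

* A. Grothendieck, *On the de Rham cohomology of algebraic varieties*, Publ. Math. IHÉS 29 (1966), footnote
  13 (variational Hodge conjecture). [Grothendieck1966deRham]
* S. Bloch, H. Esnault, M. Kerz, *Deformation of algebraic cycle classes in characteristic zero*, Algebraic
  Geometry 1 (2014) 290–310, Thm. 1.2, §7 (arXiv:1310.1773). [BlochEsnaultKerz2014CharZero]
* R.-O. Buchweitz, H. Flenner, *A semiregularity map for modules and applications to deformations*,
  Compositio Math. 137 (2003) 135–210. [BuchweitzFlenner2003]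
* Y. André, *Pour une théorie inconditionnelle des motifs*, Publ. Math. IHÉS 83 (1996), Thm. 0.5.
  [Andre1996Motifs]
* C. Voisin, *Hodge Theory and Complex Algebraic Geometry II* (2003), §2.1.1, §3.2.2, §3.3.1, §10.2.1,
  Thm. 1.23. [VoisinHodgeII2003]
* F. Charles, C. Schnell, *Notes on absolute Hodge classes*, in *Hodge Theory* (Princeton Math. Notes 49,
  2014), Conj. 11.3.1, Cor. 11.3.6, §11.3 (book pp. 477–485). [CharlesSchnell2014Notes]
* M. A. de Cataldo, L. Migliorini, *On singularities of primitive cohomology classes*, PAMS 137 (2009), §4.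
  [DecataldoMigliorini2009]
* R. P. Thomas, *Nodes and the Hodge conjecture*, J. Algebraic Geom. 14 (2005), §2, §5. [Thomas2005Nodes]
* R. Hartshorne, *Ample Subvarieties of Algebraic Varieties*, LNM 156 (1970), Ch. II (Goodman's theorems:
  Thm. 4.2, §5 Zariski–Goodman example, Thm. 6.1). [Hartshorne1970]
* J. Kollár, S. Mori, *Birational Geometry of Algebraic Varieties* (1998), Def. 2.50, Lemma 2.51 (ramified
  cyclic covers). [KollarMori1998]
-/

-- `Summit.<Summit>.<Problem>`: for the single-conjunct summit `HodgeConjecture` the duplicate component is mandated.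
set_option linter.dupNamespace false
set_option linter.unusedVariables false

noncomputable section

namespace Summit.HodgeConjecture.HodgeConjecture.Cruxes.WeakLefschetzAlgebraicClasses.SidewaysVhcSweep

open CategoryTheory AlgebraicGeometry MonoidalCategory
open Literature.AlgebraicGeometry
open Literature.AlgebraicGeometry.Motives (SchemeOver IsSmoothProjective ProjectiveEmbedding
  universalHyperplaneSection)
open Literature.AlgebraicGeometry.HodgeTheory
open Literature.AlgebraicTopology.SingularHomology
open Summit.HodgeConjecture.HodgeConjecture.Theses.AffinePartDecay
open Summit.HodgeConjecture.HodgeConjecture.Theses.AnchorTransport (VariationalHodge)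

/-! ## The five registered stubs -/

/-- **Stub (R) `stub_hodgeTypeReflected`** — HODGE TYPE IS REFLECTED ALONG `i^*` IN THE WEAK-LEFSCHETZ
RANGE (verbatim the reflection stub of `Lines/birth.lean`; theorem-grade, size M): for a closed immersion
`i : H ⟶ X` of smooth projective varieties (`dim X = n + 1`, `dim H = n`) with affine complement and
`2p ≤ n`, a class `c ∈ H²ᵖ(X(ℂ); ℂ)` whose restriction `i^*c` is algebraic on `H` is of Hodge type `(p,p)` on
`X`: `Alg^p(H) ⊆ H^{p,p}(H)` (`isOfHodgeType_of_mem_algebraicClasses_of_isSmoothProjective`), `i^*`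
preserves every Hodge type (`IsOfHodgeType.map_of_le`), the Hodge decomposition of `H` is direct, and `i^*`
is injective on `H²ᵖ` for `2p ≤ n` (`Theorems.weakLefschetzInjective_proof`).
[cite: VoisinHodgeI2002, §7.3.2 and Prop. 11.20] [cite: VoisinHodgeII2003, Thm. 1.23] -/
theorem stub_hodgeTypeReflected :
    ∀ ⦃n p : ℕ⦄ ⦃X H : SchemeOver ℂ⦄ (i : H ⟶ X), IsSmoothProjective (n + 1) X → IsSmoothProjective n H →
      IsClosedImmersion i.left →
      (∀ U : X.left.Opens, (U : Set X.left) = (Set.range i.left.base)ᶜ → IsAffineOpen U) →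
      2 * p ≤ n → ∀ (c : complexBetti X (2 * p)),
        complexBetti.map i (2 * p) c ∈ algebraicClasses H p →
        IsOfHodgeType (n + 1) X (2 * p) p p c := by
  sorry

/-- **Stub (V) `stub_variationalHodge`** — GROTHENDIECK'S VARIATIONAL HODGE CONJECTURE, imported BY NAME
as the open crux `Theses.AnchorTransport.VariationalHodge` (stmt-HodgeConjecture-1076; staffed under that
item — lines `padic_disc_transport`, `tame_symbol_splitting`, `codim_split_motivic`; André's `B ⇒ VHC`
landed as `Theorems.variationalHodge_of_standardConjectureB`). For a smooth projective family over a
smooth irreducible base, a global class that is fibrewise rational of type `(p,p)` and algebraic on one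
fibre is algebraic on every fibre. Why plausibly true: implied by the Hodge conjecture; proved for
`p = 1`, for abelian schemes in several ranges, and at the motivated level.
[cite: Grothendieck1966deRham, footnote 13] [cite: CharlesSchnell2014Notes, Conj. 11.3.1 and Cor. 11.3.6] [cite: BlochEsnaultKerz2014CharZero, Thm. 1.2 and §7]
[cite: Andre1996Motifs, Thm. 0.5] -/
theorem stub_variationalHodge : VariationalHodge := by
  sorry

/-- **Stub (A) `stub_anchorOnHyperplaneSection`** — THE ANCHOR ON ONE SMOOTH HYPERPLANE SECTION: under
the variational Hodge conjecture for PROJECTIVE smooth families (the printed form, Charles–Schnell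
Conj. 11.3.1 — the hypothesis shape of `Theorems.variationalHodge_projective_of_affine`; a special case of
`VariationalHodge`, and implied by the standard conjecture `B` over affine bases by the landed
`Theorems.variationalHodge_projective_of_standardConjectureB`), in the crux's setting (`i : H ⟶ X`, `dim X = n + 1`, `dim H = n`, affine complement, `1 ≤ p`,
`2p ≤ n`) a RATIONAL class `c` of Hodge type `(p,p)` with `i^*c ∈ Alg^p(H)` is algebraic on SOME smooth
hyperplane section `X_{a₀} = X ∩ V₊(ℓ_{a₀})` of SOME projective embedding `e : X ↪ ℙᴺ`. Very ample `H`: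
take `e` with `H` a hyperplane section. Ample `H`: cyclic `m`-fold cover branched along a general
`G ∈ |mH|`, the linear pencil `⟨π^*s_H, u⟩` on it (smooth members `π⁻¹H`, `G`, `G_t = {g = tᵐs_Hᵐ}`), VHC
along its smooth locus, `e` = the embedding by `|mH|`. Non-ample `H` with affine complement: OPEN inside
this stub (no mechanism; HC-implied) — the declared hole of the line. Size L (cyclic covers are not yet a
tree carrier). [cite: KollarMori1998, Def. 2.50 and Lemma 2.51] [cite: Hartshorne1970, II Thm. 4.2, §5 and Thm. 6.1] [cite: VoisinHodgeII2003, §2.1.1] -/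
theorem stub_anchorOnHyperplaneSection :
    (∀ ⦃k : ℕ⦄ ⦃𝒳 S : SchemeOver ℂ⦄ (f : 𝒳 ⟶ S), Motives.IsSmoothProjectiveFamily f k →
      (∃ (N : ℕ) (ι : 𝒳 ⟶ Motives.projectiveSpace N ℂ ⊗ S), IsClosedImmersion ι.left ∧
        ι ≫ CartesianMonoidalCategory.snd (Motives.projectiveSpace N ℂ) S = f) →
      IrreducibleSpace S.left → AlgebraicGeometry.Smooth S.hom →
      ∀ (q : ℕ) (A : complexBetti 𝒳 (2 * q)),
      (∀ s : Motives.ComplexPoints S, HodgeTheory.IsRationalClass (complexBetti.map (Motives.fiberι f s) (2 * q) A) ∧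
        IsOfHodgeType k (Motives.fiberOver f s) (2 * q) q q (complexBetti.map (Motives.fiberι f s) (2 * q) A)) →
      (∃ s₀ : Motives.ComplexPoints S,
        complexBetti.map (Motives.fiberι f s₀) (2 * q) A ∈ algebraicClasses (Motives.fiberOver f s₀) q) →
      ∀ s : Motives.ComplexPoints S,
        complexBetti.map (Motives.fiberι f s) (2 * q) A ∈ algebraicClasses (Motives.fiberOver f s) q) →
    ∀ ⦃n p : ℕ⦄ ⦃X H : SchemeOver ℂ⦄ (i : H ⟶ X), IsSmoothProjective (n + 1) X → IsSmoothProjective n H →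
      IsClosedImmersion i.left →
      (∀ U : X.left.Opens, (U : Set X.left) = (Set.range i.left.base)ᶜ → IsAffineOpen U) →
      2 * p ≤ n → 1 ≤ p → ∀ (c : complexBetti X (2 * p)), HodgeTheory.IsRationalClass c →
        IsOfHodgeType (n + 1) X (2 * p) p p c →
        complexBetti.map i (2 * p) c ∈ algebraicClasses H p →
        ∃ (e : ProjectiveEmbedding X) (a₀ : Fin (e.n + 1) → ℂ) (_ : a₀ ≠ 0),
          IsSmoothProjective n (e.hypersurfaceSection (linForm e.n a₀) (isHomogeneous_linForm e.n a₀)) ∧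
          complexBetti.map (e.hypersurfaceSectionι (linForm e.n a₀) (isHomogeneous_linForm e.n a₀)) (2 * p) c ∈
            algebraicClasses (e.hypersurfaceSection (linForm e.n a₀) (isHomogeneous_linForm e.n a₀)) p := by
  sorry

/-- **Stub (T) `stub_sidewaysTransfer`** — SIDEWAYS BY VHC ACROSS THE SMOOTH HYPERPLANE SECTIONS: under the
variational Hodge conjecture for PROJECTIVE smooth families (same hypothesis as in stub (A); the universal
hyperplane family `𝒴_U ⊂ X × U ⟶ U` IS projective over its base, so only the printed form is needed),
for `X` smooth projective of dimension `n + 1` with a projective embedding `e`, a RATIONAL class `c` of Hodge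
type `(p,p)` on `X` which is algebraic on ONE smooth hyperplane section `X_{a₀}` of `e` is algebraic on EVERY
smooth hyperplane section `X_a` of `e`. Mechanism: the smooth (geometrically integral) hyperplane sections are
the fibres of the universal family `𝒴 ⟶ (ℙᴺ)^*` over its good locus `U`, open in `(ℙᴺ)^*` hence smooth and
irreducible (`Motives.UniversalHyperplaneSectionFamilyGoodLocus`, `HodgeTheory.HyperplaneSectionFamilyGoodFibres`);
`toX^* c` is fibrewise rational and `(p,p)`; VHC transports algebraicity from `[a₀]` to `[a]`; transport under
the iso `X_a ≅ 𝒴_{[a]}` (`map_mem_algebraicClasses_of_isIso`). Size M.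
[cite: VoisinHodgeII2003, §2.1.1 and §3.2.2] [cite: Grothendieck1966deRham, footnote 13] -/
theorem stub_sidewaysTransfer :
    (∀ ⦃k : ℕ⦄ ⦃𝒳 S : SchemeOver ℂ⦄ (f : 𝒳 ⟶ S), Motives.IsSmoothProjectiveFamily f k →
      (∃ (N : ℕ) (ι : 𝒳 ⟶ Motives.projectiveSpace N ℂ ⊗ S), IsClosedImmersion ι.left ∧
        ι ≫ CartesianMonoidalCategory.snd (Motives.projectiveSpace N ℂ) S = f) →
      IrreducibleSpace S.left → AlgebraicGeometry.Smooth S.hom →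
      ∀ (q : ℕ) (A : complexBetti 𝒳 (2 * q)),
      (∀ s : Motives.ComplexPoints S, HodgeTheory.IsRationalClass (complexBetti.map (Motives.fiberι f s) (2 * q) A) ∧
        IsOfHodgeType k (Motives.fiberOver f s) (2 * q) q q (complexBetti.map (Motives.fiberι f s) (2 * q) A)) →
      (∃ s₀ : Motives.ComplexPoints S,
        complexBetti.map (Motives.fiberι f s₀) (2 * q) A ∈ algebraicClasses (Motives.fiberOver f s₀) q) →
      ∀ s : Motives.ComplexPoints S,
        complexBetti.map (Motives.fiberι f s) (2 * q) A ∈ algebraicClasses (Motives.fiberOver f s) q) →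
    ∀ ⦃n p : ℕ⦄ ⦃X : SchemeOver ℂ⦄, IsSmoothProjective (n + 1) X → ∀ (e : ProjectiveEmbedding X)
      (c : complexBetti X (2 * p)), HodgeTheory.IsRationalClass c → IsOfHodgeType (n + 1) X (2 * p) p p c →
      (∃ (a₀ : Fin (e.n + 1) → ℂ) (_ : a₀ ≠ 0),
        IsSmoothProjective n (e.hypersurfaceSection (linForm e.n a₀) (isHomogeneous_linForm e.n a₀)) ∧
        complexBetti.map (e.hypersurfaceSectionι (linForm e.n a₀) (isHomogeneous_linForm e.n a₀)) (2 * p) c ∈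
          algebraicClasses (e.hypersurfaceSection (linForm e.n a₀) (isHomogeneous_linForm e.n a₀)) p) →
      ∀ (a : Fin (e.n + 1) → ℂ), a ≠ 0 →
        IsSmoothProjective n (e.hypersurfaceSection (linForm e.n a) (isHomogeneous_linForm e.n a)) →
        complexBetti.map (e.hypersurfaceSectionι (linForm e.n a) (isHomogeneous_linForm e.n a)) (2 * p) c ∈
          algebraicClasses (e.hypersurfaceSection (linForm e.n a) (isHomogeneous_linForm e.n a)) p := by
  sorry

/-- **Stub (S) `stub_universalSpread`** — SPREADING FIBREWISE ALGEBRAIC CLASSES OVER THE COMPLETE LINEAR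
SYSTEM (the hypothesis `hS` of the tree's `HodgeTheory.mem_algebraicClasses_of_two_mul_le_of_spread`,
verbatim but guarded by `1 ≤ p`, `2p ≤ m`): for `X` smooth projective of dimension `m + 1` with a projective
embedding `e` and a rational class `c ∈ H²ᵖ(X(ℂ); ℂ)` algebraic on every smooth hyperplane section of `e`,
there is ONE algebraic class `ξ ∈ Alg^p(𝒴)` on the universal hyperplane section `𝒴 ⊂ X × (ℙᴺ)^*` whose
restriction to the fibre over some smooth `X_a` (through `v : X_a ⟶ 𝒴` over the slice `X × {[a]}`) is a
positive integer multiple of `c|_{X_a}`. Mechanism (print-routine, size L): relative Hilbert scheme of `𝒴/(ℙᴺ)^*`,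
countability and Baire over the good locus, a dominating component and a multisection, closure `𝒵 ⊂ 𝒴` of
codimension `p`, purity on the fibres and AVERAGING over the finite monodromy of the components
(`c|_{X_a}` is invariant), `ξ := Σ μ_i [𝒵_i]`. The `ℙ¹`-base analogue (I) is the PROVED
`spread_supports_over_projectiveLine_holds`; the averaging half is the tree's stated leaf (II)
`vertical_rigidity_supportedClasses_projectiveLine`. Documented tree gap (`IncidenceDivisorDescent`, module
docstring: "needs relative Hilbert/Chow schemes of `𝒴/P` and the countability argument").
[cite: VoisinHodgeII2003, §3.3.1 and §10.2.1] [cite: CharlesSchnell2014Notes, §11.3]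
[cite: DeligneHodgeIII1974, Cor. 8.2.8] -/
theorem stub_universalSpread :
    ∀ ⦃m : ℕ⦄ ⦃X : SchemeOver ℂ⦄ (_ : IsSmoothProjective (m + 1) X)
      (e : ProjectiveEmbedding X) (p : ℕ) (c : complexBetti X (2 * p)), 1 ≤ p → 2 * p ≤ m →
      HodgeTheory.IsRationalClass c →
      (∀ (a : Fin (e.n + 1) → ℂ), a ≠ 0 →
        IsSmoothProjective m (e.hypersurfaceSection (linForm e.n a) (isHomogeneous_linForm e.n a)) →
        complexBetti.map (e.hypersurfaceSectionι (linForm e.n a) (isHomogeneous_linForm e.n a))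
          (2 * p) c ∈
          algebraicClasses (e.hypersurfaceSection (linForm e.n a) (isHomogeneous_linForm e.n a)) p) →
      ∃ ξ : complexBetti (universalHyperplaneSection e.n e.ι) (2 * p),
        ξ ∈ algebraicClasses (universalHyperplaneSection e.n e.ι) p ∧
        ∃ (a : Fin (e.n + 1) → ℂ) (ha : a ≠ 0),
          IsSmoothProjective m (e.hypersurfaceSection (linForm e.n a) (isHomogeneous_linForm e.n a)) ∧
          ∃ (r : ℕ) (v : e.hypersurfaceSection (linForm e.n a) (isHomogeneous_linForm e.n a) ⟶
              universalHyperplaneSection e.n e.ι),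
            0 < r ∧
            v ≫ Motives.UniversalHyperplaneSection.emb e.n e.ι =
              e.hypersurfaceSectionι (linForm e.n a) (isHomogeneous_linForm e.n a) ≫
                Motives.sliceAt X (Motives.ProjectiveSpace.pointOfVec ℂ a ha) ∧
            complexBetti.map v (2 * p) ξ =
              (r : ℂ) • complexBetti.map (e.hypersurfaceSectionι (linForm e.n a)
                (isHomogeneous_linForm e.n a)) (2 * p) c := by
  sorry

/-! ## Sorry-free glue -/

set_option maxHeartbeats 800000 in
/-- **The composition with explicit hypotheses** (`stub_R → VHC → stub_A → stub_T → stub_S → crux`, the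
crux `WeakLefschetzAlgebraicClasses` written out one step so that `WeakLefschetzAlgebraicClasses_of` below is
the file's only theorem headed by the crux name). `p = 0`: `Alg⁰ = ⊤` (`algebraicClasses_zero`). `p ≥ 1`:
REFLECTION (`hR`) gives the Hodge type `(p,p)` of `c`; the ANCHOR (`hA`) gives an embedding `e` and one
smooth hyperplane section on which `c` is algebraic; SIDEWAYS (`hT`) makes `c` algebraic on every smooth
hyperplane section of `e`; SPREADING (`hS`) gives `ξ ∈ Alg^p(𝒴)` over a smooth `X_a`; `𝒴` is smooth
projective of dimension `n + N` (`Motives.isSmoothProjective_universalHyperplaneSection`, `N ≥ n + 1 ≥ 2` by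
`le_of_isClosedImmersion_projectiveSpace`); `H²ᵖ(X) → H²ᵖ(X_a)` is injective for `2p ≤ n`
(`injective_complexBettiMap_hypersurfaceSection`); the landed incidence-divisor DESCENT
`mem_algebraicClasses_of_spread` concludes. Sorry-free; standard axioms.
[cite: VoisinHodgeII2003, §1.2.2 Thm. 1.23 and §3.3.1] [cite: DecataldoMigliorini2009, §4 proof of Prop. 4.5] -/
theorem weakLefschetz_of_pieces
    (hR : ∀ ⦃n p : ℕ⦄ ⦃X H : SchemeOver ℂ⦄ (i : H ⟶ X), IsSmoothProjective (n + 1) X →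
      IsSmoothProjective n H → IsClosedImmersion i.left →
      (∀ U : X.left.Opens, (U : Set X.left) = (Set.range i.left.base)ᶜ → IsAffineOpen U) →
      2 * p ≤ n → ∀ (c : complexBetti X (2 * p)),
        complexBetti.map i (2 * p) c ∈ algebraicClasses H p →
        IsOfHodgeType (n + 1) X (2 * p) p p c)
    (hV : VariationalHodge)
    (hA : (∀ ⦃k : ℕ⦄ ⦃𝒳 S : SchemeOver ℂ⦄ (f : 𝒳 ⟶ S), Motives.IsSmoothProjectiveFamily f k →
      (∃ (N : ℕ) (ι : 𝒳 ⟶ Motives.projectiveSpace N ℂ ⊗ S), IsClosedImmersion ι.left ∧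
        ι ≫ CartesianMonoidalCategory.snd (Motives.projectiveSpace N ℂ) S = f) →
      IrreducibleSpace S.left → AlgebraicGeometry.Smooth S.hom →
      ∀ (q : ℕ) (A : complexBetti 𝒳 (2 * q)),
      (∀ s : Motives.ComplexPoints S, HodgeTheory.IsRationalClass (complexBetti.map (Motives.fiberι f s) (2 * q) A) ∧
        IsOfHodgeType k (Motives.fiberOver f s) (2 * q) q q (complexBetti.map (Motives.fiberι f s) (2 * q) A)) →
      (∃ s₀ : Motives.ComplexPoints S,
        complexBetti.map (Motives.fiberι f s₀) (2 * q) A ∈ algebraicClasses (Motives.fiberOver f s₀) q) →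
      ∀ s : Motives.ComplexPoints S,
        complexBetti.map (Motives.fiberι f s) (2 * q) A ∈ algebraicClasses (Motives.fiberOver f s) q) →
      ∀ ⦃n p : ℕ⦄ ⦃X H : SchemeOver ℂ⦄ (i : H ⟶ X), IsSmoothProjective (n + 1) X → IsSmoothProjective n H →
      IsClosedImmersion i.left →
      (∀ U : X.left.Opens, (U : Set X.left) = (Set.range i.left.base)ᶜ → IsAffineOpen U) →
      2 * p ≤ n → 1 ≤ p → ∀ (c : complexBetti X (2 * p)), HodgeTheory.IsRationalClass c →
        IsOfHodgeType (n + 1) X (2 * p) p p c →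
        complexBetti.map i (2 * p) c ∈ algebraicClasses H p →
        ∃ (e : ProjectiveEmbedding X) (a₀ : Fin (e.n + 1) → ℂ) (_ : a₀ ≠ 0),
          IsSmoothProjective n (e.hypersurfaceSection (linForm e.n a₀) (isHomogeneous_linForm e.n a₀)) ∧
          complexBetti.map (e.hypersurfaceSectionι (linForm e.n a₀) (isHomogeneous_linForm e.n a₀)) (2 * p) c ∈
            algebraicClasses (e.hypersurfaceSection (linForm e.n a₀) (isHomogeneous_linForm e.n a₀)) p)
    (hT : (∀ ⦃k : ℕ⦄ ⦃𝒳 S : SchemeOver ℂ⦄ (f : 𝒳 ⟶ S), Motives.IsSmoothProjectiveFamily f k →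
      (∃ (N : ℕ) (ι : 𝒳 ⟶ Motives.projectiveSpace N ℂ ⊗ S), IsClosedImmersion ι.left ∧
        ι ≫ CartesianMonoidalCategory.snd (Motives.projectiveSpace N ℂ) S = f) →
      IrreducibleSpace S.left → AlgebraicGeometry.Smooth S.hom →
      ∀ (q : ℕ) (A : complexBetti 𝒳 (2 * q)),
      (∀ s : Motives.ComplexPoints S, HodgeTheory.IsRationalClass (complexBetti.map (Motives.fiberι f s) (2 * q) A) ∧
        IsOfHodgeType k (Motives.fiberOver f s) (2 * q) q q (complexBetti.map (Motives.fiberι f s) (2 * q) A)) →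
      (∃ s₀ : Motives.ComplexPoints S,
        complexBetti.map (Motives.fiberι f s₀) (2 * q) A ∈ algebraicClasses (Motives.fiberOver f s₀) q) →
      ∀ s : Motives.ComplexPoints S,
        complexBetti.map (Motives.fiberι f s) (2 * q) A ∈ algebraicClasses (Motives.fiberOver f s) q) →
      ∀ ⦃n p : ℕ⦄ ⦃X : SchemeOver ℂ⦄, IsSmoothProjective (n + 1) X → ∀ (e : ProjectiveEmbedding X)
      (c : complexBetti X (2 * p)), HodgeTheory.IsRationalClass c → IsOfHodgeType (n + 1) X (2 * p) p p c →
      (∃ (a₀ : Fin (e.n + 1) → ℂ) (_ : a₀ ≠ 0),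
        IsSmoothProjective n (e.hypersurfaceSection (linForm e.n a₀) (isHomogeneous_linForm e.n a₀)) ∧
        complexBetti.map (e.hypersurfaceSectionι (linForm e.n a₀) (isHomogeneous_linForm e.n a₀)) (2 * p) c ∈
          algebraicClasses (e.hypersurfaceSection (linForm e.n a₀) (isHomogeneous_linForm e.n a₀)) p) →
      ∀ (a : Fin (e.n + 1) → ℂ), a ≠ 0 →
        IsSmoothProjective n (e.hypersurfaceSection (linForm e.n a) (isHomogeneous_linForm e.n a)) →
        complexBetti.map (e.hypersurfaceSectionι (linForm e.n a) (isHomogeneous_linForm e.n a)) (2 * p) c ∈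
          algebraicClasses (e.hypersurfaceSection (linForm e.n a) (isHomogeneous_linForm e.n a)) p)
    (hS : ∀ ⦃m : ℕ⦄ ⦃X : SchemeOver ℂ⦄ (_ : IsSmoothProjective (m + 1) X)
      (e : ProjectiveEmbedding X) (p : ℕ) (c : complexBetti X (2 * p)), 1 ≤ p → 2 * p ≤ m →
      HodgeTheory.IsRationalClass c →
      (∀ (a : Fin (e.n + 1) → ℂ), a ≠ 0 →
        IsSmoothProjective m (e.hypersurfaceSection (linForm e.n a) (isHomogeneous_linForm e.n a)) →
        complexBetti.map (e.hypersurfaceSectionι (linForm e.n a) (isHomogeneous_linForm e.n a))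
          (2 * p) c ∈
          algebraicClasses (e.hypersurfaceSection (linForm e.n a) (isHomogeneous_linForm e.n a)) p) →
      ∃ ξ : complexBetti (universalHyperplaneSection e.n e.ι) (2 * p),
        ξ ∈ algebraicClasses (universalHyperplaneSection e.n e.ι) p ∧
        ∃ (a : Fin (e.n + 1) → ℂ) (ha : a ≠ 0),
          IsSmoothProjective m (e.hypersurfaceSection (linForm e.n a) (isHomogeneous_linForm e.n a)) ∧
          ∃ (r : ℕ) (v : e.hypersurfaceSection (linForm e.n a) (isHomogeneous_linForm e.n a) ⟶
              universalHyperplaneSection e.n e.ι),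
            0 < r ∧
            v ≫ Motives.UniversalHyperplaneSection.emb e.n e.ι =
              e.hypersurfaceSectionι (linForm e.n a) (isHomogeneous_linForm e.n a) ≫
                Motives.sliceAt X (Motives.ProjectiveSpace.pointOfVec ℂ a ha) ∧
            complexBetti.map v (2 * p) ξ =
              (r : ℂ) • complexBetti.map (e.hypersurfaceSectionι (linForm e.n a)
                (isHomogeneous_linForm e.n a)) (2 * p) c) :
    ∀ ⦃n p : ℕ⦄ ⦃X H : SchemeOver ℂ⦄ (i : H ⟶ X), IsSmoothProjective (n + 1) X →
      IsSmoothProjective n H → IsClosedImmersion i.left →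
      (∀ U : X.left.Opens, (U : Set X.left) = (Set.range i.left.base)ᶜ → IsAffineOpen U) →
      2 * p ≤ n → ∀ (c : complexBetti X (2 * p)), HodgeTheory.IsRationalClass c →
      complexBetti.map i (2 * p) c ∈ algebraicClasses H p → c ∈ algebraicClasses X p := by
  intro n p X H i hX hH hi hU hp c hc halg
  -- `p = 0`: `Alg⁰(X) = H⁰(X(ℂ); ℂ)`
  rcases Nat.eq_zero_or_pos p with rfl | hp0
  · rw [algebraicClasses_zero]
    exact Submodule.mem_top
  -- reflection: `c` is of Hodge type `(p,p)`
  have hHodge : IsOfHodgeType (n + 1) X (2 * p) p p c := hR i hX hH hi hU hp c halg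
  -- the variational Hodge conjecture for PROJECTIVE families (the printed form) is a special case
  have hVp : ∀ ⦃k : ℕ⦄ ⦃𝒳 S : SchemeOver ℂ⦄ (f : 𝒳 ⟶ S), Motives.IsSmoothProjectiveFamily f k →
      (∃ (N : ℕ) (ι : 𝒳 ⟶ Motives.projectiveSpace N ℂ ⊗ S), IsClosedImmersion ι.left ∧
        ι ≫ CartesianMonoidalCategory.snd (Motives.projectiveSpace N ℂ) S = f) →
      IrreducibleSpace S.left → AlgebraicGeometry.Smooth S.hom →
      ∀ (q : ℕ) (A : complexBetti 𝒳 (2 * q)),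
      (∀ s : Motives.ComplexPoints S, HodgeTheory.IsRationalClass (complexBetti.map (Motives.fiberι f s) (2 * q) A) ∧
        IsOfHodgeType k (Motives.fiberOver f s) (2 * q) q q (complexBetti.map (Motives.fiberι f s) (2 * q) A)) →
      (∃ s₀ : Motives.ComplexPoints S,
        complexBetti.map (Motives.fiberι f s₀) (2 * q) A ∈ algebraicClasses (Motives.fiberOver f s₀) q) →
      ∀ s : Motives.ComplexPoints S,
        complexBetti.map (Motives.fiberι f s) (2 * q) A ∈ algebraicClasses (Motives.fiberOver f s) q :=
    fun k 𝒳 S f hf _ hirr hsm q A hA' hs₀ s ↦ hV f hf hirr hsm q A hA' hs₀ s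
  -- anchor: an embedding `e` and one smooth hyperplane section on which `c` is algebraic
  obtain ⟨e, a₀, ha₀, hXa₀, halg₀⟩ := hA hVp i hX hH hi hU hp hp0 c hc hHodge halg
  -- sideways: `c` is algebraic on every smooth hyperplane section of `e`
  have hfib : ∀ (a : Fin (e.n + 1) → ℂ), a ≠ 0 →
      IsSmoothProjective n (e.hypersurfaceSection (linForm e.n a) (isHomogeneous_linForm e.n a)) →
      complexBetti.map (e.hypersurfaceSectionι (linForm e.n a) (isHomogeneous_linForm e.n a)) (2 * p) c ∈
        algebraicClasses (e.hypersurfaceSection (linForm e.n a) (isHomogeneous_linForm e.n a)) p :=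
    hT hVp hX e c hc hHodge ⟨a₀, ha₀, hXa₀, halg₀⟩
  -- spreading over the complete linear system
  obtain ⟨ξ, hξ, a, ha, hXa, r, v, hr, hv, hvξ⟩ := hS hX e p c hp0 hp hc hfib
  -- the universal hyperplane section is smooth projective of dimension `n + N`, `N ≥ n + 1 ≥ 2`
  have hN : n + 1 ≤ e.n := le_of_isClosedImmersion_projectiveSpace hX e.ι
  have hY : IsSmoothProjective (n + e.n) (universalHyperplaneSection e.n e.ι) :=
    Motives.isSmoothProjective_universalHyperplaneSection hX e.ι (by omega)
  -- descent through the incidence divisor (landed)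
  exact mem_algebraicClasses_of_spread hX e.ι hY (by omega) (by omega) c hξ
    (Motives.ProjectiveSpace.pointOfVec ℂ a ha) _
    (injective_complexBettiMap_hypersurfaceSection hX e le_rfl (linForm e.n a)
      (isHomogeneous_linForm e.n a) hXa hp) v hv (r := (r : ℂ)) (Nat.cast_ne_zero.2 hr.ne') hvξ

/-! ## The skeleton theorem: the crux BY NAME from the five declared stubs -/

/-- **THE SKELETON THEOREM.** The crux
`Summit.HodgeConjecture.HodgeConjecture.Theses.AffinePartDecay.WeakLefschetzAlgebraicClasses`, concluded
BY NAME from the five DECLARED stubs (the only `sorry`s of the file) through the sorry-free composition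
`weakLefschetz_of_pieces`. [cite: VoisinHodgeII2003, §3.3.1 and §10.2.1] [cite: BlochEsnaultKerz2014CharZero, §7] -/
theorem WeakLefschetzAlgebraicClasses_of :
    Summit.HodgeConjecture.HodgeConjecture.Theses.AffinePartDecay.WeakLefschetzAlgebraicClasses :=
  weakLefschetz_of_pieces stub_hodgeTypeReflected stub_variationalHodge stub_anchorOnHyperplaneSection
    stub_sidewaysTransfer stub_universalSpread

end Summit.HodgeConjecture.HodgeConjecture.Cruxes.WeakLefschetzAlgebraicClasses.SidewaysVhcSweep

end
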